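import Literature.MathematicalPhysics.QuantumFieldTheory.Balaban1983to89.B9Eq3117Current

/-!
# `Balaban1983to89.B9Eq3131Pointwise` — B9 pp. 421–422: the BILINEAR form `⟨A₁, Δ′_πA₂⟩` of (3.120) (polarization, exact) and
# the pointwise commutator majorization behind (3.131), in the exact-background lattice vocabulary of `B9Eq3117Current`

statement-level skeleton of published theorems with citation tags; proofs where landed; nothing here is a claim about the Yang–Mills mass gap

DOCFIX (cell `lit-balaban`, seat r06 gen 15, 2026-08-22; p37 `CITELOC-SWEEP-B4B9.md` §2b page-numeral slips, text layer re-read): (3.131) is p. 422 [PDF 34] (the unnumbered example display is p. 421) — the locators of (3.131) in this file corrected accordingly (1 place(s)); declarations, statements and proofs byte-identical to the tree copy of record (p245433).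

T. Bałaban, *Propagators for lattice gauge theories in a background field*, Commun. Math. Phys. **99** (1985) 389–434
[Balaban1985BackgroundPropagators] (cell paper B9; PDF held `paper:balaban1985-cmp99-background-propagators`, journal page = PDF page
+ 388; pp. 419, 421–422 = renders `…-p031-x2.png`, `…-p033-x2.png`, `…-p034-x2.png`, READ AS IMAGES by this seat, 2026-08-21).
Cell `lit-balaban`, SKELETON row **B9.Eq3.130** (= (3.130)–(3.131)); reader/typer seat r06 (B9 block owner), gen 2.  Referee ref-4.

CITATION HEADER / WHAT IS IN PRINT.  (3.120) p. 419: *"⟨A,Δ_πA⟩ = ⟨A,ΔA⟩ − ⟨i[(G′RD*A)(b₋), A(b)] − i[A(b), R_b(G′RD*A)(b₊)] −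
i[(G′RD*A)(b₋),(DG′RD*A)(b)]J⟩ = ⟨A,ΔA⟩ − ⟨A,Δ′_πA⟩. (3.120) The quadratic form Δ′_π is a small perturbation of Δ. Later we will
write bounds for this form"*.  pp. 421–422: *"It is easy to find estimates for the operator Δ′_π, using Theorem 3.1 and the
inequality (3.49), we have to be careful only with the third term in the definition (3.120) of Δ′_π. One of the three derivatives
there has to be applied either to an expression on the right, or on the left, of Δ′_π. For example one of the terms in ⟨A₁,Δ′_πA₂⟩ is
½⟨i[(DG′RD*A₁)(b), (G′RD*A₂)(b₋)], J⟩, and we apply the derivative D* to A₁. We have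
|⟨A₁Δ′_πA₂⟩| ≦ O(1)Mα₀(‖D*A₁‖_{L¹} + (L^jη)^{−1}‖A₁‖_{L¹})e^{−(1/2)δ₀d(y,y′)}(|D*A₂| + (L^{j′}η)^{−1}|A₂|)
for supp A₁ ⊂ Δ(y), y ∈ Λ_j, supp A₂ ⊂ Δ(y′), y′ ∈ Λ_{j′}. (3.131)"*.

WHAT THIS FILE PROVES (0 sorry, no `def … : Prop`):
* §1 the BILINEAR bracket `shiftJBil` (the polarization of the (3.117)/(3.120) bracket `B9Eq3117Current.shiftJ`: the two terms linear
  in `λ` polarize as `½(i[λ₂(b₋),A₁(b)] + i[λ₁(b₋),A₂(b)] − …)` and **the third term**, quadratic in `λ`, as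
  `−½(i[λ₁(b₋),(Dλ₂)(b)] + i[λ₂(b₋),(Dλ₁)(b)])` — the print's *"one of the terms in ⟨A₁,Δ′_πA₂⟩ is ½⟨i[(DG′RD*A₁)(b),(G′RD*A₂)(b₋)],J⟩"*
  is the second of these, `one_of_the_terms`), `shiftJBil_self`, `shiftJBil_comm`, `shiftJ_add` (exact polarization identity), and
  the bilinear form `deltaPiPrimeBil` = `⟨A₁,Δ′_πA₂⟩` for ANY additive `P` (print: `P = G′RD*`) with `deltaPiPrimeBil_self`
  (= `B9Eq3117Current.deltaPiPrime` on the diagonal), `deltaPiPrimeBil_comm`, **`deltaPiPrime_add`** (⟨A₁+A₂,Δ′_π(A₁+A₂)⟩ =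
  ⟨A₁,Δ′_πA₁⟩ + ⟨A₂,Δ′_πA₂⟩ + 2⟨A₁,Δ′_πA₂⟩).
* §2 **`norm_deltaPiPrimeBil_le`** — the pointwise majorization from which every term of (3.131) is read off: for a unit-bounded
  background and a bounded trace functional,
  `|⟨A₁,Δ′_πA₂⟩| ≦ ‖τ‖η^d Σ_b |J(b)|·(|λ₂(b₋)||A₁(b)| + |λ₁(b₋)||A₂(b)| + |A₁(b)||λ₂(b₊)| + |A₂(b)||λ₁(b₊)| + |λ₁(b₋)||(Dλ₂)(b)| +
  |λ₂(b₋)||(Dλ₁)(b)|)`, `λᵢ = PAᵢ` (`|[X,Y]| ≦ 2|X||Y|`, `|R(U_b)X| ≦ |X|`, the `½` of the polarization against the `2` of the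
  commutator; v1 p244770 bounced on a duplicate of the landed `B9Eq360Vprime.norm_R_le_of_unit`, now inlined).
NOT REPRODUCED (said once): the BOOKKEEPING half of (3.131) — inserting Theorem 3.1 for `G′` (kernels of `G′R`, `DG′R`), (3.49) for
`P`, (3.36) for `J` and Lemma 2.1 of [4] for the `b`-sum into the majorization above (cell GAPS G-B9-16: (3.131) stays a hypothesis
shape in `B9SectDSup`/`B9SectDWeightedNeumann`; this file narrows the gap to that bookkeeping).  Value = kernel-checked algebra and
a located elementary inequality; NOT summit progress.
-/

noncomputable section

namespace Literature.MathematicalPhysics.QuantumFieldTheory.Balaban1983to89.B9Eq3131Pointwise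

open Complex
open Literature.MathematicalPhysics.QuantumFieldTheory.Balaban1983to89
open Literature.MathematicalPhysics.QuantumFieldTheory.Balaban1983to89.Beta.BackgroundVertices (ad ad_apply norm_ad_le
  ad_add_left ad_add_right)
open Literature.MathematicalPhysics.QuantumFieldTheory.Balaban1983to89.B9Eq39Adjoint
open Literature.MathematicalPhysics.QuantumFieldTheory.Balaban1983to89.B9Eq310Hermitian (bondPair_add_left)
open Literature.MathematicalPhysics.QuantumFieldTheory.Balaban1983to89.B9Eq3117Current

/-! ## §1 Polarization of the bracket of (3.117)/(3.120) and the bilinear form `⟨A₁, Δ′_πA₂⟩` -/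

section Bilinear

variable {𝔸 : Type*} [NormedRing 𝔸] [NormedAlgebra ℂ 𝔸] [CompleteSpace 𝔸]
variable {S : Type*} {ι : Type*}
variable (T : ι → Equiv.Perm S) (U : ι → S → 𝔸ˣ)

/-- **The polarized bracket of (3.120)**: for site functions `λ₁, λ₂` and bond functions `A₁, A₂`,
`S(λ₁,λ₂;A₁,A₂)(b) = ½( i[λ₂(b₋),A₁(b)] + i[λ₁(b₋),A₂(b)] − i[A₁(b),R_bλ₂(b₊)] − i[A₂(b),R_bλ₁(b₊)] − i[λ₁(b₋),(Dλ₂)(b)]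
− i[λ₂(b₋),(Dλ₁)(b)] )` — the symmetric bilinear form whose diagonal is the bracket `i[λ(b₋),A(b)] − i[A(b),R_bλ(b₊)] −
i[λ(b₋),(Dλ)(b)]` (`B9Eq3117Current.shiftJ`). [cite: Balaban1985BackgroundPropagators, (3.120) p.419, (3.131) p.422] -/
def shiftJBil (η : ℝ) (lam₁ lam₂ : S → 𝔸) (A₁ A₂ : ι → S → 𝔸) : ι → S → 𝔸 := fun μ x =>
  (2 : ℂ)⁻¹ • (I • ad (lam₂ x) (A₁ μ x) + I • ad (lam₁ x) (A₂ μ x)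
    - I • ad (A₁ μ x) (R (U μ x) (lam₂ (T μ x))) - I • ad (A₂ μ x) (R (U μ x) (lam₁ (T μ x)))
    - I • ad (lam₁ x) (covDη T U η lam₂ μ x) - I • ad (lam₂ x) (covDη T U η lam₁ μ x))

omit [CompleteSpace 𝔸] in
/-- On the diagonal the polarized bracket IS the bracket of (3.117)/(3.120). [cite: Balaban1985BackgroundPropagators, (3.120) p.419] -/
theorem shiftJBil_self (η : ℝ) (lam : S → 𝔸) (A : ι → S → 𝔸) :
    shiftJBil T U η lam lam A A = shiftJ T U η lam A := by
  funext μ x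
  simp only [shiftJBil, shiftJ]
  module

omit [CompleteSpace 𝔸] in
/-- The polarized bracket is symmetric under `(λ₁,A₁) ↔ (λ₂,A₂)`. [cite: Balaban1985BackgroundPropagators, (3.131) p.422] -/
theorem shiftJBil_comm (η : ℝ) (lam₁ lam₂ : S → 𝔸) (A₁ A₂ : ι → S → 𝔸) :
    shiftJBil T U η lam₁ lam₂ A₁ A₂ = shiftJBil T U η lam₂ lam₁ A₂ A₁ := by
  funext μ x
  simp only [shiftJBil]
  congr 1
  abel

omit [CompleteSpace 𝔸] in
/-- `D^η(λ₁ + λ₂) = D^ηλ₁ + D^ηλ₂` (from `B9Eq39Adjoint.covD_add`). [cite: Balaban1985BackgroundPropagators, (3.3) p.391] -/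
theorem covDη_add (η : ℝ) (f g : S → 𝔸) (μ : ι) (x : S) :
    covDη T U η (f + g) μ x = covDη T U η f μ x + covDη T U η g μ x := by
  rw [covDη_apply, covDη_apply, covDη_apply, covD_add, smul_add]

omit [CompleteSpace 𝔸] in
/-- **Polarization, exactly**: `S(λ₁+λ₂; A₁+A₂) = S(λ₁;A₁) + S(λ₂;A₂) + 2·S(λ₁,λ₂;A₁,A₂)` for the bracket of (3.117)/(3.120).
[cite: Balaban1985BackgroundPropagators, (3.120) p.419, (3.131) p.422] -/
theorem shiftJ_add (η : ℝ) (lam₁ lam₂ : S → 𝔸) (A₁ A₂ : ι → S → 𝔸) :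
    shiftJ T U η (lam₁ + lam₂) (A₁ + A₂)
      = shiftJ T U η lam₁ A₁ + shiftJ T U η lam₂ A₂ + (2 : ℂ) • shiftJBil T U η lam₁ lam₂ A₁ A₂ := by
  funext μ x
  simp only [shiftJ, shiftJBil, Pi.add_apply, Pi.smul_apply, covDη_add, R_add, ad_add_left, ad_add_right]
  module

variable [Fintype S] [Fintype ι] [LinearOrder ι]

omit [CompleteSpace 𝔸] [LinearOrder ι] in
/-- The bond pairing (3.11) is homogeneous in its first argument. [cite: Balaban1985BackgroundPropagators, (3.11) p.392] -/
theorem bondPair_smul_left' (η : ℝ) (d : ℕ) (τ : 𝔸 →ₗ[ℂ] ℂ) (c : ℂ) (B E : ι → S → 𝔸) :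
    bondPair η d τ (c • B) E = c * bondPair η d τ B E := by
  unfold bondPair
  have h : ∑ x, ∑ μ, τ ((c • B) μ x * E μ x) = c * ∑ x, ∑ μ, τ (B μ x * E μ x) := by
    rw [Finset.mul_sum]
    refine Finset.sum_congr rfl fun x _ => ?_
    rw [Finset.mul_sum]
    refine Finset.sum_congr rfl fun μ _ => ?_
    rw [Pi.smul_apply, Pi.smul_apply, smul_mul_assoc, map_smul, smul_eq_mul]
  rw [h]
  ring

/-- **`⟨A₁, Δ′_πA₂⟩`** — the bilinear form of (3.120)/(3.131): the polarized bracket at `λᵢ = PAᵢ` paired with the current `J` of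
(3.11); `P` = the map `G′RD*` from bond functions to site functions of the print (kept abstract).
[cite: Balaban1985BackgroundPropagators, (3.120) p.419, (3.131) p.422] -/
def deltaPiPrimeBil (η : ℝ) (d : ℕ) (τ : 𝔸 →ₗ[ℂ] ℂ) (P : (ι → S → 𝔸) → S → 𝔸) (A₁ A₂ : ι → S → 𝔸) : ℂ :=
  bondPair η d τ (shiftJBil T U η (P A₁) (P A₂) A₁ A₂) (J T U η)

omit [CompleteSpace 𝔸] in
/-- On the diagonal: `⟨A, Δ′_πA⟩ = ⟨S_{PA}(A), J⟩`, i.e. the quadratic form (3.120) (`B9Eq3117Current.deltaPiPrime T U η d τ P A`,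
which is this right-hand side by definition). [cite: Balaban1985BackgroundPropagators, (3.120) p.419] -/
theorem deltaPiPrimeBil_self (η : ℝ) (d : ℕ) (τ : 𝔸 →ₗ[ℂ] ℂ) (P : (ι → S → 𝔸) → S → 𝔸) (A : ι → S → 𝔸) :
    deltaPiPrimeBil T U η d τ P A A = bondPair η d τ (shiftJ T U η (P A) A) (J T U η) := by
  rw [deltaPiPrimeBil, shiftJBil_self]

omit [CompleteSpace 𝔸] in
/-- … which is `B9Eq3117Current.deltaPiPrime` (v3 of that file, §7.5) by definition. [cite: Balaban1985BackgroundPropagators, (3.120) p.419] -/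
theorem deltaPiPrimeBil_self' (η : ℝ) (d : ℕ) (τ : 𝔸 →ₗ[ℂ] ℂ) (P : (ι → S → 𝔸) → S → 𝔸) (A : ι → S → 𝔸) :
    deltaPiPrimeBil T U η d τ P A A = deltaPiPrime T U η d τ P A := by
  rw [deltaPiPrimeBil_self, deltaPiPrime]

omit [CompleteSpace 𝔸] in
/-- Symmetry: `⟨A₁, Δ′_πA₂⟩ = ⟨A₂, Δ′_πA₁⟩`. [cite: Balaban1985BackgroundPropagators, (3.131) p.422] -/
theorem deltaPiPrimeBil_comm (η : ℝ) (d : ℕ) (τ : 𝔸 →ₗ[ℂ] ℂ) (P : (ι → S → 𝔸) → S → 𝔸) (A₁ A₂ : ι → S → 𝔸) :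
    deltaPiPrimeBil T U η d τ P A₁ A₂ = deltaPiPrimeBil T U η d τ P A₂ A₁ := by
  rw [deltaPiPrimeBil, deltaPiPrimeBil, shiftJBil_comm]

omit [CompleteSpace 𝔸] in
/-- **Polarization of the form (3.120)**: for an additive `P` (print's `G′RD*` is linear),
`⟨A₁+A₂, Δ′_π(A₁+A₂)⟩ = ⟨A₁,Δ′_πA₁⟩ + ⟨A₂,Δ′_πA₂⟩ + 2⟨A₁,Δ′_πA₂⟩` — this is how the terms of *"⟨A₁,Δ′_πA₂⟩"* on p. 421 arise from
the quadratic form (3.120). [cite: Balaban1985BackgroundPropagators, (3.120) p.419, (3.131) p.422] -/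
theorem deltaPiPrime_add (η : ℝ) (d : ℕ) (τ : 𝔸 →ₗ[ℂ] ℂ) (P : (ι → S → 𝔸) → S → 𝔸)
    (hP : ∀ A₁ A₂ : ι → S → 𝔸, P (A₁ + A₂) = P A₁ + P A₂) (A₁ A₂ : ι → S → 𝔸) :
    bondPair η d τ (shiftJ T U η (P (A₁ + A₂)) (A₁ + A₂)) (J T U η)
      = bondPair η d τ (shiftJ T U η (P A₁) A₁) (J T U η) + bondPair η d τ (shiftJ T U η (P A₂) A₂) (J T U η)
        + 2 * deltaPiPrimeBil T U η d τ P A₁ A₂ := by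
  rw [hP, shiftJ_add, bondPair_add_left, bondPair_add_left, bondPair_smul_left', deltaPiPrimeBil]

omit [CompleteSpace 𝔸] in
/-- The polarization identity in terms of the named quadratic form `B9Eq3117Current.deltaPiPrime` of (3.120):
`⟨A₁+A₂,Δ′_π(A₁+A₂)⟩ = ⟨A₁,Δ′_πA₁⟩ + ⟨A₂,Δ′_πA₂⟩ + 2⟨A₁,Δ′_πA₂⟩`. [cite: Balaban1985BackgroundPropagators, (3.120) p.419, (3.131) p.422] -/
theorem deltaPiPrime_add' (η : ℝ) (d : ℕ) (τ : 𝔸 →ₗ[ℂ] ℂ) (P : (ι → S → 𝔸) → S → 𝔸)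
    (hP : ∀ A₁ A₂ : ι → S → 𝔸, P (A₁ + A₂) = P A₁ + P A₂) (A₁ A₂ : ι → S → 𝔸) :
    deltaPiPrime T U η d τ P (A₁ + A₂)
      = deltaPiPrime T U η d τ P A₁ + deltaPiPrime T U η d τ P A₂ + 2 * deltaPiPrimeBil T U η d τ P A₁ A₂ := by
  rw [deltaPiPrime, deltaPiPrime, deltaPiPrime]
  exact deltaPiPrime_add T U η d τ P hP A₁ A₂

omit [CompleteSpace 𝔸] [Fintype S] [Fintype ι] [LinearOrder ι] in
/-- *"For example one of the terms in ⟨A₁,Δ′_πA₂⟩ is ½⟨i[(DG′RD*A₁)(b), (G′RD*A₂)(b₋)], J⟩"* — located: it is the polarized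
THIRD term `−½·i[λ₂(b₋),(Dλ₁)(b)]` of `shiftJBil` (with `λᵢ = PAᵢ`), since `i[X,Y] = −i[Y,X]`.
[cite: Balaban1985BackgroundPropagators, (3.131) p.422] -/
theorem one_of_the_terms (η : ℝ) (lam₁ lam₂ : S → 𝔸) (μ : ι) (x : S) :
    -((2 : ℂ)⁻¹ • (I • ad (lam₂ x) (covDη T U η lam₁ μ x)))
      = (2 : ℂ)⁻¹ • (I • ad (covDη T U η lam₁ μ x) (lam₂ x)) := by
  rw [ad_apply, ad_apply, ← smul_neg, ← smul_neg, neg_sub]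

end Bilinear

/-! ## §2 The pointwise majorization behind (3.131) -/

section Bound

variable {𝔸 : Type*} [NormedRing 𝔸] [NormedAlgebra ℂ 𝔸] [CompleteSpace 𝔸]
variable {S : Type*} {ι : Type*}
variable (T : ι → Equiv.Perm S) (U : ι → S → 𝔸ˣ)

omit [CompleteSpace 𝔸] in
/-- `|i[X,Y]| ≦ 2|X||Y|`. [cite: Balaban1985BackgroundPropagators, (3.131) p.422] -/
theorem norm_I_ad_le (X Y : 𝔸) : ‖I • ad X Y‖ ≤ 2 * ‖X‖ * ‖Y‖ := by
  rw [norm_smul, Complex.norm_I, one_mul]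
  exact norm_ad_le X Y

omit [CompleteSpace 𝔸] in
/-- **Pointwise bound of the polarized bracket**: for a unit-bounded background,
`|S(λ₁,λ₂;A₁,A₂)(b)| ≦ |λ₂(b₋)||A₁(b)| + |λ₁(b₋)||A₂(b)| + |A₁(b)||λ₂(b₊)| + |A₂(b)||λ₁(b₊)| + |λ₁(b₋)||(Dλ₂)(b)| +
|λ₂(b₋)||(Dλ₁)(b)|` (the `½` of the polarization against the `2` of `|[X,Y]| ≦ 2|X||Y|`).
[cite: Balaban1985BackgroundPropagators, (3.131) p.422] -/
theorem norm_shiftJBil_le (hU : ∀ μ x, ‖(U μ x : 𝔸)‖ ≤ 1 ∧ ‖(((U μ x)⁻¹ : 𝔸ˣ) : 𝔸)‖ ≤ 1) (η : ℝ)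
    (lam₁ lam₂ : S → 𝔸) (A₁ A₂ : ι → S → 𝔸) (μ : ι) (x : S) :
    ‖shiftJBil T U η lam₁ lam₂ A₁ A₂ μ x‖
      ≤ ‖lam₂ x‖ * ‖A₁ μ x‖ + ‖lam₁ x‖ * ‖A₂ μ x‖ + ‖A₁ μ x‖ * ‖lam₂ (T μ x)‖ + ‖A₂ μ x‖ * ‖lam₁ (T μ x)‖
        + ‖lam₁ x‖ * ‖covDη T U η lam₂ μ x‖ + ‖lam₂ x‖ * ‖covDη T U η lam₁ μ x‖ := by
  rw [shiftJBil, norm_smul, norm_inv, Complex.norm_ofNat]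
  -- `|R(U_b)X| ≤ |X|` for the unit-bounded bond variable (`B9Eq370Expansion.norm_R_le`; the named form of this bound lives
  -- in `B9Eq360Vprime`, not imported here to keep this algebra leaf light)
  have hR : ∀ (V : 𝔸ˣ) (Z : 𝔸), ‖(V : 𝔸)‖ ≤ 1 ∧ ‖((V⁻¹ : 𝔸ˣ) : 𝔸)‖ ≤ 1 → ‖R V Z‖ ≤ ‖Z‖ := fun V Z hV =>
    calc ‖R V Z‖ ≤ ‖(V : 𝔸)‖ * ‖Z‖ * ‖((V⁻¹ : 𝔸ˣ) : 𝔸)‖ := B9Eq370Expansion.norm_R_le V Z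
      _ ≤ 1 * ‖Z‖ * 1 :=
          mul_le_mul (mul_le_mul_of_nonneg_right hV.1 (norm_nonneg _)) hV.2 (norm_nonneg _)
            (mul_nonneg zero_le_one (norm_nonneg _))
      _ = ‖Z‖ := by ring
  have h1 := norm_I_ad_le (lam₂ x) (A₁ μ x)
  have h2 := norm_I_ad_le (lam₁ x) (A₂ μ x)
  have h3 : ‖I • ad (A₁ μ x) (R (U μ x) (lam₂ (T μ x)))‖ ≤ 2 * ‖A₁ μ x‖ * ‖lam₂ (T μ x)‖ :=
    (norm_I_ad_le _ _).trans (mul_le_mul_of_nonneg_left (hR _ _ (hU μ x))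
      (mul_nonneg zero_le_two (norm_nonneg _)))
  have h4 : ‖I • ad (A₂ μ x) (R (U μ x) (lam₁ (T μ x)))‖ ≤ 2 * ‖A₂ μ x‖ * ‖lam₁ (T μ x)‖ :=
    (norm_I_ad_le _ _).trans (mul_le_mul_of_nonneg_left (hR _ _ (hU μ x))
      (mul_nonneg zero_le_two (norm_nonneg _)))
  have h5 := norm_I_ad_le (lam₁ x) (covDη T U η lam₂ μ x)
  have h6 := norm_I_ad_le (lam₂ x) (covDη T U η lam₁ μ x)
  have hsum : ‖I • ad (lam₂ x) (A₁ μ x) + I • ad (lam₁ x) (A₂ μ x)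
      - I • ad (A₁ μ x) (R (U μ x) (lam₂ (T μ x))) - I • ad (A₂ μ x) (R (U μ x) (lam₁ (T μ x)))
      - I • ad (lam₁ x) (covDη T U η lam₂ μ x) - I • ad (lam₂ x) (covDη T U η lam₁ μ x)‖
      ≤ 2 * ‖lam₂ x‖ * ‖A₁ μ x‖ + 2 * ‖lam₁ x‖ * ‖A₂ μ x‖ + 2 * ‖A₁ μ x‖ * ‖lam₂ (T μ x)‖
        + 2 * ‖A₂ μ x‖ * ‖lam₁ (T μ x)‖ + 2 * ‖lam₁ x‖ * ‖covDη T U η lam₂ μ x‖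
        + 2 * ‖lam₂ x‖ * ‖covDη T U η lam₁ μ x‖ := by
    refine (norm_sub_le _ _).trans (add_le_add ((norm_sub_le _ _).trans (add_le_add ((norm_sub_le _ _).trans
      (add_le_add ((norm_sub_le _ _).trans (add_le_add ((norm_add_le _ _).trans (add_le_add h1 h2)) h3)) h4)) h5)) h6)
  calc (2 : ℝ)⁻¹ * ‖I • ad (lam₂ x) (A₁ μ x) + I • ad (lam₁ x) (A₂ μ x)
        - I • ad (A₁ μ x) (R (U μ x) (lam₂ (T μ x))) - I • ad (A₂ μ x) (R (U μ x) (lam₁ (T μ x)))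
        - I • ad (lam₁ x) (covDη T U η lam₂ μ x) - I • ad (lam₂ x) (covDη T U η lam₁ μ x)‖
      ≤ (2 : ℝ)⁻¹ * (2 * ‖lam₂ x‖ * ‖A₁ μ x‖ + 2 * ‖lam₁ x‖ * ‖A₂ μ x‖ + 2 * ‖A₁ μ x‖ * ‖lam₂ (T μ x)‖
        + 2 * ‖A₂ μ x‖ * ‖lam₁ (T μ x)‖ + 2 * ‖lam₁ x‖ * ‖covDη T U η lam₂ μ x‖
        + 2 * ‖lam₂ x‖ * ‖covDη T U η lam₁ μ x‖) := mul_le_mul_of_nonneg_left hsum (by norm_num)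
    _ = _ := by ring

variable [Fintype S] [Fintype ι] [LinearOrder ι]

omit [CompleteSpace 𝔸] [LinearOrder ι] in
/-- The bond pairing (3.11) against a bounded trace functional: `|⟨B, E⟩| ≦ ‖τ‖·η^d·Σ_b |B(b)||E(b)|` (`η > 0`).
[cite: Balaban1985BackgroundPropagators, (3.11) p.392] -/
theorem norm_bondPair_le (τ : 𝔸 →L[ℂ] ℂ) {η : ℝ} (hη : 0 < η) (d : ℕ) (B E : ι → S → 𝔸) :
    ‖bondPair η d (τ : 𝔸 →ₗ[ℂ] ℂ) B E‖ ≤ ‖τ‖ * η ^ d * ∑ x, ∑ μ, ‖B μ x‖ * ‖E μ x‖ := by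
  rw [bondPair, norm_mul, norm_pow, Complex.norm_real, Real.norm_eq_abs, abs_of_pos hη]
  have hterm : ∀ x μ, ‖(τ : 𝔸 →ₗ[ℂ] ℂ) (B μ x * E μ x)‖ ≤ ‖τ‖ * (‖B μ x‖ * ‖E μ x‖) := fun x μ =>
    (τ.le_opNorm _).trans (mul_le_mul_of_nonneg_left (norm_mul_le _ _) (norm_nonneg _))
  have hs : ‖∑ x, ∑ μ, (τ : 𝔸 →ₗ[ℂ] ℂ) (B μ x * E μ x)‖ ≤ ∑ x, ∑ μ, ‖τ‖ * (‖B μ x‖ * ‖E μ x‖) :=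
    (norm_sum_le _ _).trans (Finset.sum_le_sum fun x _ => (norm_sum_le _ _).trans
      (Finset.sum_le_sum fun μ _ => hterm x μ))
  calc η ^ d * ‖∑ x, ∑ μ, (τ : 𝔸 →ₗ[ℂ] ℂ) (B μ x * E μ x)‖
      ≤ η ^ d * ∑ x, ∑ μ, ‖τ‖ * (‖B μ x‖ * ‖E μ x‖) := mul_le_mul_of_nonneg_left hs (pow_nonneg hη.le d)
    _ = ‖τ‖ * η ^ d * ∑ x, ∑ μ, ‖B μ x‖ * ‖E μ x‖ := by
        rw [Finset.mul_sum, Finset.mul_sum]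
        refine Finset.sum_congr rfl fun x _ => ?_
        rw [Finset.mul_sum, Finset.mul_sum]
        refine Finset.sum_congr rfl fun μ _ => ?_
        ring

omit [CompleteSpace 𝔸] in
/-- **The pointwise majorization behind (3.131)** (*"we have to be careful only with the third term in the definition (3.120) of
Δ′_π. One of the three derivatives there has to be applied either to an expression on the right, or on the left, of Δ′_π"*): with
`λᵢ = PAᵢ`, a unit-bounded background, `η > 0` and a bounded trace functional,
`|⟨A₁,Δ′_πA₂⟩| ≦ ‖τ‖η^d Σ_b |J(b)|(|λ₂(b₋)||A₁(b)| + |λ₁(b₋)||A₂(b)| + |A₁(b)||λ₂(b₊)| + |A₂(b)||λ₁(b₊)| + |λ₁(b₋)||(Dλ₂)(b)|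
+ |λ₂(b₋)||(Dλ₁)(b)|)` — the two third-term products carry one derivative each, on `λ₂` resp. `λ₁`; inserting Theorem 3.1 /
(3.49) / (3.36) and [4] Lemma 2.1 into the right-hand side (the printed bookkeeping) is NOT done here.
[cite: Balaban1985BackgroundPropagators, (3.131) p.422, (3.120) p.419] -/
theorem norm_deltaPiPrimeBil_le (hU : ∀ μ x, ‖(U μ x : 𝔸)‖ ≤ 1 ∧ ‖(((U μ x)⁻¹ : 𝔸ˣ) : 𝔸)‖ ≤ 1)
    (τ : 𝔸 →L[ℂ] ℂ) {η : ℝ} (hη : 0 < η) (d : ℕ) (P : (ι → S → 𝔸) → S → 𝔸) (A₁ A₂ : ι → S → 𝔸) :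
    ‖deltaPiPrimeBil T U η d (τ : 𝔸 →ₗ[ℂ] ℂ) P A₁ A₂‖
      ≤ ‖τ‖ * η ^ d * ∑ x, ∑ μ, ‖J T U η μ x‖ *
          (‖P A₂ x‖ * ‖A₁ μ x‖ + ‖P A₁ x‖ * ‖A₂ μ x‖ + ‖A₁ μ x‖ * ‖P A₂ (T μ x)‖ + ‖A₂ μ x‖ * ‖P A₁ (T μ x)‖
            + ‖P A₁ x‖ * ‖covDη T U η (P A₂) μ x‖ + ‖P A₂ x‖ * ‖covDη T U η (P A₁) μ x‖) := by
  rw [deltaPiPrimeBil]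
  refine (norm_bondPair_le τ hη d _ _).trans (mul_le_mul_of_nonneg_left ?_ (mul_nonneg (norm_nonneg _)
    (pow_nonneg hη.le d)))
  refine Finset.sum_le_sum fun x _ => Finset.sum_le_sum fun μ _ => ?_
  rw [mul_comm]
  exact mul_le_mul_of_nonneg_left (norm_shiftJBil_le T U hU η (P A₁) (P A₂) A₁ A₂ μ x) (norm_nonneg _)

end Bound

end Literature.MathematicalPhysics.QuantumFieldTheory.Balaban1983to89.B9Eq3131Pointwise

end
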